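import Literature.NumberTheory.Transcendental.LineODEGens
import Literature.NumberTheory.Transcendental.SemistableTorsion
import HarnessLib

/-!
# Generator values at the multiples `s·v` of a point with torsion abelian part

Topic: `Literature/NumberTheory/Transcendental`. Plan item W4/S2c of the unit
`provefact-Literature.NumberTheory.Transcendental.H-b596640137`. In Baker's method on `M_κ` the
auxiliary function is evaluated at the multiples `s·v`, `0 ≤ s ≤ S`, of a point `v` whose
`E`-coordinates are `N`-torsion (`SemistableTorsion.lean`: the dévissage only produces such
points). This file PROVES that the line generators of `LineODEGens.lean` at `s·v` (adapted chart
`chartChoiceAt (s·v)`) are governed by `s = qN + r` as follows: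

* torus: `E_j(s·v) = (e^{y_j(v)})^s` (`genFun_torus_mul`);
* `E`-factors: the chart choice and the two factor generators at `s·v` coincide with those at
  `r·v` (`chartChoiceAt_mul`, `genFun_factor_mul`: `℘, ℘′` are `Λ`-periodic, `u = p = 0` on `Λ`);
* fibre: **`Ñ_e(s·v) = q · Ñ_e(N·v) + Ñ_e(r·v)`** (`genFun_fibre_mul`) — from the
  quasi-periodicity `ζ(z + λ) = ζ(z) + η(λ)` for all lattice vectors `λ` (the tree's
  `PeriodPair.weierstrassZeta_add_period`, `WeierstrassAdditionProofs.lean`) and `g(λ) = η(λ)`;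
* `torsionCoords_of_mem_algTors` — the bridge from the tree's torsion notion: a point of
  `Std.AlgTors` (`SemistableTorsion.lean`: per-coordinate orders `N_b ≥ 1`) admits `TorsionCoords`
  for the common order `N = ∏_b N_b > 0`.

Hence ALL generator values at all `s·v` lie in the ring generated by the finitely many algebraic
numbers `e^{y_j(v)}`, the factor generators at `r·v` (`r < N`), `Ñ_e(N·v)`, `Ñ_e(r·v)`, with
heights growing linearly in `s` — the shape required by Siegel's lemma and the Liouville estimate
(Baker–Wüstholz 2007, §6.8, p. 119: "`log max |f_i(sv)| ≪ s`").

## References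

* A. Baker, G. Wüstholz, *Logarithmic Forms and Diophantine Geometry*, CUP 2007, §6.8.
* E. T. Whittaker, G. N. Watson, *A Course of Modern Analysis*, §20.41.
-/

noncomputable section

open Complex
open scoped PeriodPair

namespace Literature.NumberTheory.Transcendental

namespace GaGmE

namespace Std

variable {β γ δ : Type} [Fintype β] [Fintype γ] [Fintype δ] [DecidableEq γ]
variable (L : PeriodPair) (κM : δ → γ → Kbar)

/-! ### Points with torsion `E`-coordinates and their multiples -/

/-- Lattice coordinates of `N·z'_b(v)`: the `E`-coordinates of `v` are `N`-torsion for a COMMON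
`N`, with chosen integer coordinates `(m_b, n_b)` of `N z'_b(v) ∈ Λ`. The tree's torsion notions are
`PeriodPair.IsTorsionPt` and `Std.AlgTors` (`SemistableTorsion.lean`, per-coordinate orders
`N_b ≥ 1`); `torsionCoords_of_mem_algTors` below produces this structure from them with
`N = ∏_b N_b`. [folklore] -/
structure TorsionCoords (v : β ⊕ (γ ⊕ δ) → ℂ) (N : ℕ) where
  /-- first lattice coordinate of `N z'_b` -/
  m : γ → ℤ
  /-- second lattice coordinate of `N z'_b` -/
  n : γ → ℤ
  /-- `N z'_b = m_b ω₁ + n_b ω₂` -/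
  eq : ∀ b, (N : ℂ) * v (iz b) = m b * L.ω₁ + n b * L.ω₂

variable {L}
variable {v : β ⊕ (γ ⊕ δ) → ℂ} {N : ℕ}

omit [Fintype β] [Fintype γ] [Fintype δ] [DecidableEq γ] in
/-- `s·z'_b = r·z'_b + q·(N z'_b)` for `s = qN + r`. [folklore] -/
theorem TorsionCoords.mul_coord (tc : TorsionCoords L v N) (q r : ℕ) (b : γ) :
    ((q * N + r : ℕ) : ℂ) * v (iz b) =
      (r : ℂ) * v (iz b) + ((q * tc.m b : ℤ) * L.ω₁ + (q * tc.n b : ℤ) * L.ω₂) := by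
  have := tc.eq b
  push_cast
  linear_combination (q : ℂ) * this

omit [Fintype β] [Fintype γ] [Fintype δ] [DecidableEq γ] in
/-- Lattice membership of `s·z'_b` only depends on `s mod N`. [folklore] -/
theorem TorsionCoords.mem_lattice_iff (tc : TorsionCoords L v N) (q r : ℕ) (b : γ) :
    ((q * N + r : ℕ) : ℂ) * v (iz b) ∈ L.lattice ↔ (r : ℂ) * v (iz b) ∈ L.lattice := by
  rw [tc.mul_coord q r b]
  have hl := L.int_mul_add_int_mul_mem_lattice (q * tc.m b) (q * tc.n b)
  constructor
  · intro h
    simpa using L.lattice.sub_mem h hl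
  · intro h
    exact L.lattice.add_mem h hl

omit [Fintype β] [Fintype γ] [Fintype δ] [DecidableEq γ] in
/-- **The adapted chart choice at `s·v` is that at `r·v`**, `s = qN + r`. [folklore] -/
theorem chartChoiceAt_mul (tc : TorsionCoords L v N) (q r : ℕ) :
    chartChoiceAt L (((q * N + r : ℕ) : ℂ) • v) = chartChoiceAt L (β := β) (δ := δ) ((r : ℂ) • v) := by
  funext b
  simp only [chartChoiceAt, Pi.smul_apply, smul_eq_mul]
  by_cases h : (r : ℂ) * v (iz b) ∈ L.lattice
  · rw [if_pos h, if_pos ((tc.mem_lattice_iff q r b).mpr h)]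
  · rw [if_neg h, if_neg (mt (tc.mem_lattice_iff q r b).mp h)]

omit [Fintype β] [Fintype δ] [DecidableEq γ] in
/-- **Torus generators at multiples**: `E_j(s·v) = (e^{y_j(v)})^s`. [folklore] -/
theorem genFun_torus_mul (c : γ → Bool) (x : β ⊕ (γ ⊕ δ) → ℂ) (s : ℕ) (j : β) :
    genFun L κM c ((s : ℂ) • v) x 0 (Sum.inl j) = cexp (v (iy j)) ^ s := by
  simp [genFun, ← Complex.exp_nat_mul]

omit [Fintype β] [Fintype δ] [DecidableEq γ] in
/-- **Factor generators at multiples**: with the adapted charts, the factor generators at `s·v`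
equal those at `r·v`, `s = qN + r` (`℘, ℘′` are periodic; `u = p = 0` on the lattice). [folklore] -/
theorem genFun_factor_mul (tc : TorsionCoords L v N) (x : β ⊕ (γ ⊕ δ) → ℂ) (q r : ℕ) (b : γ) (i : Fin 2) :
    genFun L κM (chartChoiceAt L (((q * N + r : ℕ) : ℂ) • v)) (((q * N + r : ℕ) : ℂ) • v) x 0
        (Sum.inr (Sum.inl (b, i))) =
      genFun L κM (chartChoiceAt L ((r : ℂ) • v)) ((r : ℂ) • v) x 0 (Sum.inr (Sum.inl (b, i))) := by
  rw [chartChoiceAt_mul tc]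
  simp only [genFun, Pi.smul_apply, smul_eq_mul, zero_mul, add_zero]
  by_cases hr : (r : ℂ) * v (iz b) ∈ L.lattice
  · -- origin chart at both points: `u = p = 0`
    have hcb : chartChoiceAt L ((r : ℂ) • v) b = true := by
      simp [chartChoiceAt, Pi.smul_apply, smul_eq_mul, hr]
    have hs : ((q * N + r : ℕ) : ℂ) * v (iz b) ∈ L.lattice := (tc.mem_lattice_iff q r b).mpr hr
    obtain ⟨m₁, n₁, h₁⟩ := PeriodPair.mem_lattice.mp hs
    obtain ⟨m₂, n₂, h₂⟩ := PeriodPair.mem_lattice.mp hr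
    have v1 := L.latU_latP_latG_lattice m₁ n₁
    have v2 := L.latU_latP_latG_lattice m₂ n₂
    rw [h₁] at v1
    rw [h₂] at v2
    rw [hcb]
    fin_cases i
    · simp only [factorGen_true, Fin.zero_eta, Matrix.cons_val_zero]
      rw [v1.2.1, v2.2.1]
    · simp only [factorGen_true, Fin.mk_one, Matrix.cons_val_one, Matrix.cons_val_fin_one]
      rw [v1.2.2.1, v2.2.2.1]
  · have hcb : chartChoiceAt L ((r : ℂ) • v) b = false := by
      simp [chartChoiceAt, Pi.smul_apply, smul_eq_mul, hr]
    rw [hcb, tc.mul_coord q r b]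
    have hl := L.int_mul_add_int_mul_mem_lattice (q * tc.m b) (q * tc.n b)
    fin_cases i
    · simpa using L.weierstrassP_add_coe ((r : ℂ) * v (iz b)) ⟨_, hl⟩
    · simpa using L.derivWeierstrassP_add_coe ((r : ℂ) * v (iz b)) ⟨_, hl⟩

omit [Fintype β] [Fintype γ] [Fintype δ] [DecidableEq γ] in
/-- The `ζ`-type function of the adapted chart at a multiple: `ζ̂(s z'_b) = ζ̂(r z'_b) + q η(N z'_b)`.
[folklore] -/
theorem zetaHat_mul (tc : TorsionCoords L v N) (q r : ℕ) (b : γ) :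
    zetaHat L (chartChoiceAt L (((q * N + r : ℕ) : ℂ) • v) b) (((q * N + r : ℕ) : ℂ) * v (iz b)) =
      zetaHat L (chartChoiceAt L (β := β) (δ := δ) ((r : ℂ) • v) b) ((r : ℂ) * v (iz b)) +
        ((q * tc.m b : ℤ) * L.η₁ + (q * tc.n b : ℤ) * L.η₂) := by
  rw [chartChoiceAt_mul tc]
  by_cases hr : (r : ℂ) * v (iz b) ∈ L.lattice
  · -- both lattice points: `g = η` is additive in the lattice coordinates
    have hcb : chartChoiceAt L ((r : ℂ) • v) b = true := by
      simp [chartChoiceAt, Pi.smul_apply, smul_eq_mul, hr]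
    obtain ⟨m₂, n₂, h₂⟩ := PeriodPair.mem_lattice.mp hr
    rw [hcb, zetaHat_true, zetaHat_true]
    have e1 : ((q * N + r : ℕ) : ℂ) * v (iz b) =
        ((m₂ + q * tc.m b : ℤ) : ℂ) * L.ω₁ + ((n₂ + q * tc.n b : ℤ) : ℂ) * L.ω₂ := by
      rw [tc.mul_coord q r b, ← h₂]; push_cast; ring
    rw [e1, (L.latU_latP_latG_lattice _ _).2.2.2, ← h₂, (L.latU_latP_latG_lattice _ _).2.2.2]
    push_cast; ring
  · have hcb : chartChoiceAt L ((r : ℂ) • v) b = false := by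
      simp [chartChoiceAt, Pi.smul_apply, smul_eq_mul, hr]
    rw [hcb, zetaHat_false, zetaHat_false, tc.mul_coord q r b, L.weierstrassZeta_add_period]

omit [Fintype β] [Fintype δ] [DecidableEq γ] in
/-- **Fibre generators at multiples**: `Ñ_e(s·v) = q·Ñ_e(N·v) + Ñ_e(r·v)` for `s = qN + r`.
[cite: BakerWustholz2007, §6.8 (p. 119)] -/
theorem genFun_fibre_mul (tc : TorsionCoords L v N) (x : β ⊕ (γ ⊕ δ) → ℂ) (q r : ℕ) (e : δ) :
    genFun L κM (chartChoiceAt L (((q * N + r : ℕ) : ℂ) • v)) (((q * N + r : ℕ) : ℂ) • v) x 0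
        (Sum.inr (Sum.inr e)) =
      q * genFun L κM (chartChoiceAt L ((N : ℂ) • v)) ((N : ℂ) • v) x 0 (Sum.inr (Sum.inr e)) +
        genFun L κM (chartChoiceAt L ((r : ℂ) • v)) ((r : ℂ) • v) x 0 (Sum.inr (Sum.inr e)) := by
  -- the `N·v` values: all factors in the origin chart, `ζ̂ = η(N z'_b)`
  have hN : ∀ b, zetaHat L (chartChoiceAt L ((N : ℂ) • v) b) ((N : ℂ) * v (iz b)) =
      (tc.m b : ℂ) * L.η₁ + (tc.n b : ℂ) * L.η₂ := fun b => by
    have hmem : (N : ℂ) * v (iz b) ∈ L.lattice := by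
      rw [tc.eq b]; exact L.int_mul_add_int_mul_mem_lattice _ _
    have hcb : chartChoiceAt L ((N : ℂ) • v) b = true := by
      simp [chartChoiceAt, Pi.smul_apply, smul_eq_mul, hmem]
    rw [hcb, zetaHat_true, tc.eq b, (L.latU_latP_latG_lattice _ _).2.2.2]
  simp only [genFun, Pi.smul_apply, smul_eq_mul, zero_mul, add_zero]
  have hb : ∀ b, (κM e b : ℂ) * zetaHat L (chartChoiceAt L (((q * N + r : ℕ) : ℂ) • v) b)
      (((q * N + r : ℕ) : ℂ) * v (iz b)) =
      q * ((κM e b : ℂ) * zetaHat L (chartChoiceAt L ((N : ℂ) • v) b) ((N : ℂ) * v (iz b))) +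
        (κM e b : ℂ) * zetaHat L (chartChoiceAt L ((r : ℂ) • v) b) ((r : ℂ) * v (iz b)) := fun b => by
    rw [zetaHat_mul tc q r b, hN b]; push_cast; ring
  rw [Finset.sum_congr rfl fun b _ => hb b, Finset.sum_add_distrib, ← Finset.mul_sum]
  push_cast; ring

/-! ### From the tree's torsion notion -/

omit [Fintype β] [Fintype δ] in
/-- **Bridge from `Std.AlgTors`.** A point with torsion `E`-coordinates (per-coordinate orders
`N_b ≥ 1`) has `TorsionCoords` for the common order `N = ∏_b N_b > 0`. [folklore] -/
theorem torsionCoords_of_mem_algTors {w : β ⊕ (γ ⊕ δ) → ℂ} (hw : w ∈ AlgTors L κM) :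
    ∃ N : ℕ, 0 < N ∧ Nonempty (TorsionCoords L w N) := by
  classical
  obtain ⟨-, htors⟩ := hw
  choose Nb hNb hmem using htors
  refine ⟨∏ b, Nb b, Finset.prod_pos fun b _ => hNb b, ?_⟩
  have hl : ∀ b, ((∏ b', Nb b' : ℕ) : ℂ) * w (iz b) ∈ L.lattice := fun b => by
    rw [← Finset.mul_prod_erase Finset.univ Nb (Finset.mem_univ b)]
    push_cast
    rw [mul_comm ((Nb b : ℂ)), mul_assoc]
    have := L.lattice.smul_mem ((∏ b' ∈ Finset.univ.erase b, Nb b' : ℕ) : ℤ) (hmem b)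
    simpa [zsmul_eq_mul] using this
  choose m n hmn using fun b => PeriodPair.mem_lattice.mp (hl b)
  exact ⟨⟨m, n, fun b => by rw [← hmn b]⟩⟩

end Std

end GaGmE

end Literature.NumberTheory.Transcendental

end
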